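import Summits.NavierStokesRegularity.FunctionalMining.TopEigDanskin
import Summits.NavierStokesRegularity.FunctionalMining.TopEigHeatLine
import HarnessLib

/-!
# FunctionalMining — Danskin's formula: first variation of the `λ₁` moment and the heat dissipation

Search for candidate a priori estimates; no regularity claim. Cell `pub-nsfunc`, prove seat
(gen 21). Kernel form of the no-go seat's F1 PART I, Theorem 1 (c) (kernel candidate K-c, named in
`NoGo/STAGING.md`; pen proofs four-party countersigned in the cell, not a cited fact), in the slightly
more general form of a ONE-SIDED FIRST VARIATION: for smooth divergence-free fields `v, w` on the unit
torus `T^d` and a real exponent `q ≥ 1`,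

  `d⁺/dt|_{t=0} Φ_q(v + t w) = ∫ q λ₁(x)^{q−1} μ(S(v)(x); S(w)(x)) dx`,   `Φ_q = ∫ (λ₁⁺)^q`
  (`torusTopEigMoment q`),

`S = sym ∇` (`StrainL4.strainFlat`, linear in the field), `λ₁ = TopEig.lam ∘ S` (`torusStrainTopEig`),
`μ(A; M) = max {eᵀMe : e a unit top eigenvector of A}` (`TopEig.dirTopEig`, file `TopEigDanskin`).
With `w = Δv` this is the dictionary's heat dissipation (`TopEigHeatCoercive.lean`):

  `heatDissipation (∫(λ₁⁺)^q) v = − ∫ q λ₁^{q−1} μ(S; ΔS) dx`     (F1 PART I, Theorem 1 (c)).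

* `TopEig.convexOn_posPart_rpow_lam_line` — `t ↦ (λ(A + tB)⁺)^q` is convex;
* `TopEig.lam_line_nonneg`, `TopEig.torusTopEigMoment_line_eq_integral` — along `v + t w` the strain is
  `S(v) + tS(w)`, `λ₁ ≥ 0`, and `Φ_q(v + t w) = ∫ λ(S(v) + tS(w))^q`;
* `TopEig.hasDerivWithinAt_lam_line_rpow` — pointwise right derivative `q λ₁^{q−1} μ(S(v); S(w))`
  (Danskin + chain rule for `r ↦ r^q`, valid at `r = 0` since `q ≥ 1`);
* **`TopEig.hasDerivWithinAt_topEigMoment_line`** — the first-variation formula (dominated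
  convergence; the difference quotients of the convex line functions are squeezed between the secant
  slopes at `t = ±1`); `TopEig.integrable_danskinDensity`;
* **`TopEig.heatDissipation_topEigMoment_eq_integral`** — Theorem 1 (c);
  `TopEig.heatDissipation_negBotEigMoment_eq_integral` — the `−λ₃` core (apply it to `−v`);
* `TopEig.heatDissipation_topEigMoment_le_of_selection` — F1 PART I Corollary 2 (selection upper
  bound): for ANY a.e. selection `e(x)` of unit top eigenvectors, `T(v) ≤ −∫ q λ₁^{q−1} eᵀΔS e`;
  `TopEig.abs_heatDissipation_topEigMoment_le` — `|T(v)| ≤ ∫ q λ₁^{q−1} ‖ΔS‖`.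

Consistency: on Laplace eigenfields `Δv = −cv`, `μ(S; −cS) = −c λ₁` and the formula returns the tree's
calibration `q c Φ_q` (`heatDissipation_topEigMoment_of_laplacian_eq`). [ours; folklore convex analysis]
-/

noncomputable section

open MeasureTheory Set Filter Topology
open scoped InnerProductSpace

namespace Summit.NavierStokesRegularity.FunctionalMining

open Literature.Analysis.FunctionSpaces Literature.Analysis.FluidPDE

namespace TopEig

variable {d : Type*} [Fintype d] [DecidableEq d] [Nonempty d]

/-! ## 1. Convexity of the line functions `t ↦ (λ(A + tB)⁺)^q` -/

/-- `t ↦ (λ(A + tB)⁺)^q` is convex on `ℝ` for `q ≥ 1` (`λ` convex, `r ↦ (r⁺)^q` convex and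
non-decreasing). [folklore] -/
theorem convexOn_posPart_rpow_lam_line {q : ℝ} (hq : 1 ≤ q) (A B : EuclideanSpace ℝ (d × d)) :
    ConvexOn ℝ univ (fun t : ℝ => max (lam (A + t • B)) 0 ^ q) := by
  have hq0 : 0 ≤ q := by linarith
  refine ⟨convex_univ, fun s _ t _ a b ha hb hab => ?_⟩
  simp only [smul_eq_mul]
  have hlin : a • (A + s • B) + b • (A + t • B) = A + (a * s + b * t) • B := by
    calc a • (A + s • B) + b • (A + t • B)
        = (a + b) • A + (a * s + b * t) • B := by
          simp only [smul_add, smul_smul, add_smul]; abel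
      _ = A + (a * s + b * t) • B := by rw [hab, one_smul]
  have h1 : lam (A + (a * s + b * t) • B) ≤ a * lam (A + s • B) + b * lam (A + t • B) := by
    have h := (convexOn_lam (d := d)).2 (mem_univ (A + s • B)) (mem_univ (A + t • B)) ha hb hab
    rw [hlin] at h
    simpa only [smul_eq_mul] using h
  exact (posPart_rpow_mono hq0 h1).trans (posPart_rpow_convex hq _ _ ha hb hab)

omit [Fintype d] [DecidableEq d] [Nonempty d] in
/-- Secant squeeze for a convex function on `ℝ`: for `0 < t ≤ 1` the difference quotient at `0` lies
between the secant slopes on `[−1, 0]` and `[0, 1]`. [folklore] -/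
theorem abs_slope_le_of_convexOn {g : ℝ → ℝ} (hg : ConvexOn ℝ univ g) {t : ℝ} (ht : t ∈ Set.Ioc (0 : ℝ) 1) :
    |(g t - g 0) / t| ≤ |g 1 - g 0| + |g 0 - g (-1)| := by
  have h1 := hg.secant_mono (a := 0) (x := t) (y := 1) (mem_univ _) (mem_univ _) (mem_univ _)
    ht.1.ne' one_ne_zero ht.2
  have h2 := hg.secant_mono (a := 0) (x := -1) (y := t) (mem_univ _) (mem_univ _) (mem_univ _)
    (by norm_num) ht.1.ne' (by linarith [ht.1])
  simp only [sub_zero, div_one] at h1 h2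
  rw [div_neg, div_one] at h2
  rw [abs_le]
  constructor
  · linarith [abs_nonneg (g 1 - g 0), neg_abs_le (g 0 - g (-1))]
  · linarith [le_abs_self (g 1 - g 0), abs_nonneg (g 0 - g (-1))]

/-! ## 2. Lines of divergence-free fields: strain, sign, the moment as an integral of `λ(S(v) + tS(w))^q` -/

variable {v w : UnitAddTorus d → EuclideanSpace ℝ d}

/-- Along a line of smooth divergence-free fields the top strain eigenvalue is non-negative:
`0 ≤ λ(S(v)(x) + t S(w)(x))` (it is `λ₁` of the divergence-free field `v + t w`). [ours] -/
theorem lam_line_nonneg (hv : Torus.IsSmooth v) (hw : Torus.IsSmooth w) (hdv : Torus.IsDivFree v)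
    (hdw : Torus.IsDivFree w) (t : ℝ) (x : UnitAddTorus d) :
    0 ≤ lam (StrainL4.strainFlat v x + t • StrainL4.strainFlat w x) := by
  rw [← strainFlat_add_smul (hv.isContDiff (by simp)) (hw.isContDiff (by simp))]
  exact lam_strainFlat_nonneg (hv.add (hw.smul t)) (isDivFree_add_smul hv hw hdv hdw t) x

/-- The line functions `x ↦ λ(S(v)(x) + tS(w)(x))^q` are continuous. [ours] -/
theorem continuous_lam_line_rpow (hv : Torus.IsSmooth v) (hw : Torus.IsSmooth w) {q : ℝ} (hq : 0 ≤ q)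
    (t : ℝ) : Continuous fun x => lam (StrainL4.strainFlat v x + t • StrainL4.strainFlat w x) ^ q := by
  have h1 : Continuous fun x => StrainL4.strainFlat v x + t • StrainL4.strainFlat w x :=
    (StrainL4.continuous_strainFlat hv).add ((StrainL4.continuous_strainFlat hw).const_smul t)
  have h2 : Continuous fun x => lam (StrainL4.strainFlat v x + t • StrainL4.strainFlat w x) :=
    continuous_lam.comp h1
  exact h2.rpow_const fun _ => Or.inr hq

/-- **`Φ_q(v + t w) = ∫ λ(S(v) + tS(w))^q`** for smooth divergence-free `v, w` and every real `t`, `q`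
(the positive part in `torusTopEigMoment` is inactive). [ours] -/
theorem torusTopEigMoment_line_eq_integral (hv : Torus.IsSmooth v) (hw : Torus.IsSmooth w)
    (hdv : Torus.IsDivFree v) (hdw : Torus.IsDivFree w) (q t : ℝ) :
    torusTopEigMoment q (v + t • w) =
      ∫ x, lam (StrainL4.strainFlat v x + t • StrainL4.strainFlat w x) ^ q := by
  unfold torusTopEigMoment
  refine integral_congr_ae (ae_of_all _ fun x => ?_)
  show max (torusStrainTopEig (v + t • w) x) 0 ^ q =
    lam (StrainL4.strainFlat v x + t • StrainL4.strainFlat w x) ^ q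
  rw [← lam_strainFlat, strainFlat_add_smul (hv.isContDiff (by simp)) (hw.isContDiff (by simp)),
    max_eq_left (lam_line_nonneg hv hw hdv hdw t x)]

/-! ## 3. Pointwise: Danskin + chain rule -/

/-- **Pointwise right derivative of the line functions**: for every `x` and real `q ≥ 1`,
`t ↦ λ(S(v)(x) + tS(w)(x))^q` has right derivative `q λ₁(x)^{q−1} μ(S(v)(x); S(w)(x))` at `t = 0`
(`TopEig.hasDerivWithinAt_lam_line` and the chain rule for `r ↦ r^q`, valid at `r = 0` since `q ≥ 1`).
[ours] -/
theorem hasDerivWithinAt_lam_line_rpow {q : ℝ} (hq : 1 ≤ q) (v w : UnitAddTorus d → EuclideanSpace ℝ d)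
    (x : UnitAddTorus d) :
    HasDerivWithinAt (fun t : ℝ => lam (StrainL4.strainFlat v x + t • StrainL4.strainFlat w x) ^ q)
      (q * torusStrainTopEig v x ^ (q - 1) * dirTopEig (StrainL4.strainFlat v x) (StrainL4.strainFlat w x))
      (Set.Ioi 0) 0 := by
  have h1 := (hasDerivWithinAt_lam_line (StrainL4.strainFlat v x)
    (StrainL4.strainFlat w x)).rpow_const (p := q) (Or.inr hq)
  refine h1.congr_deriv ?_
  rw [zero_smul, add_zero, lam_strainFlat]
  ring

/-- The difference quotients of the line functions converge pointwise to the Danskin density.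
[ours] -/
theorem tendsto_slope_lam_line_rpow {q : ℝ} (hq : 1 ≤ q) (v w : UnitAddTorus d → EuclideanSpace ℝ d)
    (x : UnitAddTorus d) :
    Tendsto (fun t : ℝ =>
        (lam (StrainL4.strainFlat v x + t • StrainL4.strainFlat w x) ^ q -
          lam (StrainL4.strainFlat v x + (0 : ℝ) • StrainL4.strainFlat w x) ^ q) / t)
      (𝓝[>] 0)
      (𝓝 (q * torusStrainTopEig v x ^ (q - 1) *
        dirTopEig (StrainL4.strainFlat v x) (StrainL4.strainFlat w x))) := by
  have h0 : (0 : ℝ) ∉ Set.Ioi (0 : ℝ) := fun h => lt_irrefl (0 : ℝ) h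
  have h := (hasDerivWithinAt_iff_tendsto_slope' h0).1 (hasDerivWithinAt_lam_line_rpow hq v w x)
  refine h.congr' ?_
  filter_upwards [self_mem_nhdsWithin] with t _
  rw [slope_def_field, sub_zero]

/-- Uniform domination of the difference quotients for `0 < t ≤ 1` by the secant slopes at `t = ±1`
(convexity of the line functions). [ours] -/
theorem abs_slope_lam_line_rpow_le {q : ℝ} (hq : 1 ≤ q) (hv : Torus.IsSmooth v) (hw : Torus.IsSmooth w)
    (hdv : Torus.IsDivFree v) (hdw : Torus.IsDivFree w) {t : ℝ} (ht : t ∈ Set.Ioc (0 : ℝ) 1)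
    (x : UnitAddTorus d) :
    |(lam (StrainL4.strainFlat v x + t • StrainL4.strainFlat w x) ^ q -
        lam (StrainL4.strainFlat v x + (0 : ℝ) • StrainL4.strainFlat w x) ^ q) / t| ≤
      |lam (StrainL4.strainFlat v x + (1 : ℝ) • StrainL4.strainFlat w x) ^ q -
          lam (StrainL4.strainFlat v x + (0 : ℝ) • StrainL4.strainFlat w x) ^ q| +
        |lam (StrainL4.strainFlat v x + (0 : ℝ) • StrainL4.strainFlat w x) ^ q -
          lam (StrainL4.strainFlat v x + (-1 : ℝ) • StrainL4.strainFlat w x) ^ q| := by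
  have hconv : ConvexOn ℝ univ (fun t : ℝ =>
      lam (StrainL4.strainFlat v x + t • StrainL4.strainFlat w x) ^ q) := by
    refine (convexOn_posPart_rpow_lam_line hq (StrainL4.strainFlat v x)
      (StrainL4.strainFlat w x)).congr fun t _ => ?_
    show max (lam (StrainL4.strainFlat v x + t • StrainL4.strainFlat w x)) 0 ^ q = _
    rw [max_eq_left (lam_line_nonneg hv hw hdv hdw t x)]
  exact abs_slope_le_of_convexOn hconv ht

/-! ## 4. The Danskin density is integrable -/

/-- The Danskin density `x ↦ q λ₁^{q−1} μ(S(v); S(w))` is a.e.-strongly measurable (it is the pointwise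
limit of the continuous difference quotients). [ours] -/
theorem aestronglyMeasurable_danskinDensity {q : ℝ} (hq : 1 ≤ q) (hv : Torus.IsSmooth v)
    (hw : Torus.IsSmooth w) :
    AEStronglyMeasurable (fun x => q * torusStrainTopEig v x ^ (q - 1) *
      dirTopEig (StrainL4.strainFlat v x) (StrainL4.strainFlat w x)) volume := by
  have hq0 : 0 ≤ q := by linarith
  refine aestronglyMeasurable_of_tendsto_ae (𝓝[>] (0 : ℝ)) (fun t => ?_)
    (ae_of_all _ fun x => tendsto_slope_lam_line_rpow hq v w x)
  exact (((continuous_lam_line_rpow hv hw hq0 t).sub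
    (continuous_lam_line_rpow hv hw hq0 0)).div_const t).aestronglyMeasurable

/-- `λ₁` is continuous. [ours] -/
theorem continuous_torusStrainTopEig (hv : Torus.IsSmooth v) : Continuous (torusStrainTopEig v) := by
  have h : Continuous fun x => lam (StrainL4.strainFlat v x) :=
    continuous_lam.comp (StrainL4.continuous_strainFlat hv)
  exact h.congr fun x => lam_strainFlat v x

/-- The dominating function `x ↦ q λ₁^{q−1} ‖S(w)‖` is continuous (`q ≥ 1`). [ours] -/
theorem continuous_danskinBound {q : ℝ} (hq : 1 ≤ q) (hv : Torus.IsSmooth v) (hw : Torus.IsSmooth w) :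
    Continuous fun x => q * torusStrainTopEig v x ^ (q - 1) * ‖StrainL4.strainFlat w x‖ := by
  have h1 : Continuous fun x => torusStrainTopEig v x ^ (q - 1) :=
    (continuous_torusStrainTopEig hv).rpow_const fun _ => Or.inr (by linarith)
  have h2 : Continuous fun x => ‖StrainL4.strainFlat w x‖ := (StrainL4.continuous_strainFlat hw).norm
  exact (continuous_const.mul h1).mul h2

/-- Pointwise bound `|q λ₁^{q−1} μ(S(v); S(w))| ≤ q λ₁^{q−1} ‖S(w)‖` (`λ₁ ≥ 0` for divergence-free
`v`, `|μ(A; M)| ≤ ‖M‖`). [ours] -/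
theorem abs_danskinDensity_le {q : ℝ} (hq : 1 ≤ q) (hv : Torus.IsSmooth v) (hdv : Torus.IsDivFree v)
    (w : UnitAddTorus d → EuclideanSpace ℝ d) (x : UnitAddTorus d) :
    |q * torusStrainTopEig v x ^ (q - 1) * dirTopEig (StrainL4.strainFlat v x) (StrainL4.strainFlat w x)| ≤
      q * torusStrainTopEig v x ^ (q - 1) * ‖StrainL4.strainFlat w x‖ := by
  have hl : 0 ≤ torusStrainTopEig v x := by rw [← lam_strainFlat]; exact lam_strainFlat_nonneg hv hdv x
  have hc : 0 ≤ q * torusStrainTopEig v x ^ (q - 1) := mul_nonneg (by linarith) (Real.rpow_nonneg hl _)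
  rw [abs_mul, abs_of_nonneg hc]
  exact mul_le_mul_of_nonneg_left (abs_dirTopEig_le_norm _ _) hc

/-- **The Danskin density is integrable** on the torus (measurable, and dominated by the continuous
function `q λ₁^{q−1} ‖S(w)‖`). [ours] -/
theorem integrable_danskinDensity {q : ℝ} (hq : 1 ≤ q) (hv : Torus.IsSmooth v) (hw : Torus.IsSmooth w)
    (hdv : Torus.IsDivFree v) :
    Integrable (fun x => q * torusStrainTopEig v x ^ (q - 1) *
      dirTopEig (StrainL4.strainFlat v x) (StrainL4.strainFlat w x)) volume := by
  refine Integrable.mono' (continuous_danskinBound hq hv hw).integrable_unitAddTorus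
    (aestronglyMeasurable_danskinDensity hq hv hw) (ae_of_all _ fun x => ?_)
  rw [Real.norm_eq_abs]
  exact abs_danskinDensity_le hq hv hdv w x

/-! ## 5. Exchange of limit and integral: the one-sided first variation of `Φ_q` -/

/-- **One-sided first variation of the `λ₁` moment (Danskin).** For smooth divergence-free `v, w` on
`T^d` and real `q ≥ 1`, `t ↦ Φ_q(v + t w)` has right derivative `∫ q λ₁^{q−1} μ(S(v); S(w))` at `t = 0`
(dominated convergence: pointwise Danskin limits, quotients dominated by the secant slopes at
`t = ±1`). The right derivative is convex and positively homogeneous — in general NOT linear — in the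
direction `w` (`dirTopEig_add_le`, `dirTopEig_smul_of_nonneg`). [ours] -/
theorem hasDerivWithinAt_topEigMoment_line {q : ℝ} (hq : 1 ≤ q) (hv : Torus.IsSmooth v)
    (hw : Torus.IsSmooth w) (hdv : Torus.IsDivFree v) (hdw : Torus.IsDivFree w) :
    HasDerivWithinAt (fun t : ℝ => torusTopEigMoment q (v + t • w))
      (∫ x, q * torusStrainTopEig v x ^ (q - 1) *
        dirTopEig (StrainL4.strainFlat v x) (StrainL4.strainFlat w x))
      (Set.Ioi 0) 0 := by
  have hq0 : 0 ≤ q := by linarith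
  have h0 : (0 : ℝ) ∉ Set.Ioi (0 : ℝ) := fun h => lt_irrefl (0 : ℝ) h
  -- abbreviation for the line functions
  obtain ⟨f, hf⟩ : ∃ f : ℝ → UnitAddTorus d → ℝ, f = fun t x =>
      lam (StrainL4.strainFlat v x + t • StrainL4.strainFlat w x) ^ q := ⟨_, rfl⟩
  have hfc : ∀ t, Continuous (f t) := fun t => by rw [hf]; exact continuous_lam_line_rpow hv hw hq0 t
  have hg : ∀ t : ℝ, torusTopEigMoment q (v + t • w) = ∫ x, f t x := fun t => by
    rw [hf]; exact torusTopEigMoment_line_eq_integral hv hw hdv hdw q t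
  -- the slopes of the moment are the integrals of the quotients
  have hslope : ∀ t : ℝ, 0 < t →
      slope (fun t : ℝ => torusTopEigMoment q (v + t • w)) 0 t = ∫ x, (f t x - f 0 x) / t := by
    intro t _
    rw [slope_def_field, sub_zero, hg t, hg 0,
      ← integral_sub (hfc t).integrable_unitAddTorus (hfc 0).integrable_unitAddTorus, integral_div]
  -- dominated convergence
  have hlim : Tendsto (fun t : ℝ => ∫ x, (f t x - f 0 x) / t) (𝓝[>] 0)
      (𝓝 (∫ x, q * torusStrainTopEig v x ^ (q - 1) *
        dirTopEig (StrainL4.strainFlat v x) (StrainL4.strainFlat w x))) := by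
    refine tendsto_integral_filter_of_dominated_convergence
      (fun x => |f 1 x - f 0 x| + |f 0 x - f (-1) x|) ?_ ?_ ?_ ?_
    · exact Eventually.of_forall fun t => (((hfc t).sub (hfc 0)).div_const t).aestronglyMeasurable
    · filter_upwards [Ioc_mem_nhdsGT zero_lt_one] with t ht
      refine ae_of_all _ fun x => ?_
      rw [Real.norm_eq_abs, hf]
      have h := abs_slope_lam_line_rpow_le hq hv hw hdv hdw ht x
      simpa only [one_smul] using h
    · exact (((hfc 1).sub (hfc 0)).abs.add ((hfc 0).sub (hfc (-1))).abs).integrable_unitAddTorus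
    · refine ae_of_all _ fun x => ?_
      rw [hf]
      exact tendsto_slope_lam_line_rpow hq v w x
  rw [hasDerivWithinAt_iff_tendsto_slope' h0]
  refine hlim.congr' ?_
  filter_upwards [self_mem_nhdsWithin] with t ht
  exact (hslope t ht).symm

/-- The heat line: `t ↦ Φ_q(v + tΔv)` has right derivative `∫ q λ₁^{q−1} μ(S; ΔS)` at `0` for smooth
divergence-free `v`, `q ≥ 1`. [ours] -/
theorem hasDerivWithinAt_topEigMoment_heatLine {q : ℝ} (hq : 1 ≤ q) (hv : Torus.IsSmooth v)
    (hdiv : Torus.IsDivFree v) :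
    HasDerivWithinAt (fun t : ℝ => torusTopEigMoment q (v + t • Torus.laplacian v))
      (∫ x, q * torusStrainTopEig v x ^ (q - 1) *
        dirTopEig (StrainL4.strainFlat v x) (StrainL4.strainFlat (Torus.laplacian v) x))
      (Set.Ioi 0) 0 :=
  hasDerivWithinAt_topEigMoment_line hq hv hv.laplacian hdiv (isDivFree_laplacian hv hdiv)

/-! ## 6. Danskin's formula for the heat dissipation -/

/-- **Danskin's formula (F1 PART I, Theorem 1 (c); kernel candidate K-c).** For a smooth
divergence-free field `v` on `T^d` and real `q ≥ 1`:
`heatDissipation (∫(λ₁⁺)^q) v = − ∫ q λ₁(x)^{q−1} μ(S(x); ΔS(x)) dx`, where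
`μ(A; M) = max {eᵀMe : e a unit top eigenvector of A}` (`TopEig.dirTopEig`). Zero mean is not needed.
[ours] -/
theorem heatDissipation_topEigMoment_eq_integral {q : ℝ} (hq : 1 ≤ q) (hv : Torus.IsSmooth v)
    (hdiv : Torus.IsDivFree v) :
    heatDissipation (torusTopEigMoment q) v =
      -∫ x, q * torusStrainTopEig v x ^ (q - 1) *
        dirTopEig (StrainL4.strainFlat v x) (StrainL4.strainFlat (Torus.laplacian v) x) := by
  obtain ⟨_, heq⟩ := heatDissipation_topEigMoment_eq hq hv
  rw [heq, (hasDerivWithinAt_topEigMoment_heatLine hq hv hdiv).derivWithin (uniqueDiffWithinAt_Ioi 0)]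

/-- **Selection upper bound (F1 PART I, Corollary 2).** For smooth divergence-free `v`, `q ≥ 1`, and
ANY a.e. selection `e(x)` of unit top eigenvectors of `S(x)` (`e x ∈ topEigSet (S x)` a.e.) with
`x ↦ q λ₁^{q−1} e·ΔS e` integrable:
`heatDissipation (∫(λ₁⁺)^q) v ≤ − ∫ q λ₁^{q−1} e(x)ᵀ ΔS(x) e(x) dx` — a selection never underestimates
the dissipation (`eᵀΔS e ≤ μ(S; ΔS)` on the top eigen-set). [ours] -/
theorem heatDissipation_topEigMoment_le_of_selection {q : ℝ} (hq : 1 ≤ q) (hv : Torus.IsSmooth v)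
    (hdiv : Torus.IsDivFree v) {e : UnitAddTorus d → d → ℝ}
    (he : ∀ᵐ x, e x ∈ topEigSet (StrainL4.strainFlat v x))
    (hint : Integrable (fun x => q * torusStrainTopEig v x ^ (q - 1) *
      quad (StrainL4.strainFlat (Torus.laplacian v) x) (e x)) volume) :
    heatDissipation (torusTopEigMoment q) v ≤
      -∫ x, q * torusStrainTopEig v x ^ (q - 1) * quad (StrainL4.strainFlat (Torus.laplacian v) x) (e x) := by
  rw [heatDissipation_topEigMoment_eq_integral hq hv hdiv, neg_le_neg_iff]
  refine integral_mono_ae hint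
    (integrable_danskinDensity hq hv hv.laplacian hdiv) ?_
  filter_upwards [he] with x hx
  have hl : 0 ≤ torusStrainTopEig v x := by rw [← lam_strainFlat]; exact lam_strainFlat_nonneg hv hdiv x
  exact mul_le_mul_of_nonneg_left (quad_le_dirTopEig _ hx)
    (mul_nonneg (by linarith) (Real.rpow_nonneg hl _))

/-- **`|heatDissipation (∫(λ₁⁺)^q) v| ≤ ∫ q λ₁^{q−1} ‖ΔS‖`** for smooth divergence-free `v`, `q ≥ 1`
(F1 PART I, Theorem 1 (b)-type bound: the dissipation is finite and controlled by `ΔS`). [ours] -/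
theorem abs_heatDissipation_topEigMoment_le {q : ℝ} (hq : 1 ≤ q) (hv : Torus.IsSmooth v)
    (hdiv : Torus.IsDivFree v) :
    |heatDissipation (torusTopEigMoment q) v| ≤
      ∫ x, q * torusStrainTopEig v x ^ (q - 1) * ‖StrainL4.strainFlat (Torus.laplacian v) x‖ := by
  rw [heatDissipation_topEigMoment_eq_integral hq hv hdiv, abs_neg]
  exact (abs_integral_le_integral_abs).trans (integral_mono_ae
    (integrable_danskinDensity hq hv hv.laplacian hdiv).abs
    (continuous_danskinBound hq hv hv.laplacian).integrable_unitAddTorus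
    (ae_of_all _ fun x => abs_danskinDensity_le hq hv hdiv (Torus.laplacian v) x))

/-- **Danskin's formula for the `−λ₃` core**: for smooth divergence-free `v` and `q ≥ 1`,
`heatDissipation (∫((−λ₃)⁺)^q) v = − ∫ q (−λ₃(x))^{q−1} μ(−S(x); −ΔS(x)) dx` (the `λ₁` formula at `−v`:
`S(−v) = −S(v)`, `λ₁(−v) = −λ₃(v)`). [ours] -/
theorem heatDissipation_negBotEigMoment_eq_integral {q : ℝ} (hq : 1 ≤ q) (hv : Torus.IsSmooth v)
    (hdiv : Torus.IsDivFree v) :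
    heatDissipation (torusNegBotEigMoment q) v =
      -∫ x, q * (-torusStrainBotEig v x) ^ (q - 1) *
        dirTopEig (-StrainL4.strainFlat v x) (-StrainL4.strainFlat (Torus.laplacian v) x) := by
  have h := heatDissipation_topEigMoment_eq_integral hq hv.neg ((torus_isDivFree_neg_iff v).2 hdiv)
  rw [heatDissipation_neg, ← torusNegBotEigMoment_eq_comp_neg q] at h
  rw [h]
  congr 1
  refine integral_congr_ae (ae_of_all _ fun x => ?_)
  show q * torusStrainTopEig (-v) x ^ (q - 1) *
      dirTopEig (StrainL4.strainFlat (-v) x) (StrainL4.strainFlat (Torus.laplacian (-v)) x) =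
    q * (-torusStrainBotEig v x) ^ (q - 1) *
      dirTopEig (-StrainL4.strainFlat v x) (-StrainL4.strainFlat (Torus.laplacian v) x)
  rw [torusStrainTopEig_neg, torus_laplacian_neg', strainFlat_neg, strainFlat_neg]

end TopEig

end Summit.NavierStokesRegularity.FunctionalMining

end
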